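import Mathlib
import Literature.LinearAlgebra.Matrix.RankMinors
import Literature.RingTheory.Valuation.RootReduction

/-!
# `FeketeSOS.SublinearShadow` (stmt-ValiantsHypothesis-14990), line `Sketch`, reshape 5 — stub `stub_maxMinorFactor`

**Maximal-minor factorisation over a valuation subring.**  Let `O ⊂ ℂ` be a valuation subring and
`V ∈ ℂ^{m × s}`.  Then `V = H · V[a, ·]` for some `r ≤ s`, some rows `a : Fin r → m` of `V`, and an
`O`-integral matrix `H ∈ O^{m × r}` normalised by `H[a_{j'}, j] = δ_{jj'}`.

Proof (the classical maximal-minor trick).  Choose columns `I : Fin r → Fin s` forming a basis of the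
column space of `V` (`exists_linearIndependent'`) and put `W = V[·, I] ∈ ℂ^{m × r}`.  Among all row
selections `a : Fin r → m` choose one maximising the valuation of the minor `det W[a, ·]` (a finite
set of candidates; the maximum is a nonzero minor because `W` has rank `r`, so that some `r × r` minor of
`W` is nonzero).  With `M = W[a, ·]` and `H = W · M⁻¹`:
* `H[a, ·] = M · M⁻¹ = 1`;
* by Cramer's rule `H_{bj} = det M_j(W_b) / det M`, where `M_j(W_b)` — the matrix `M` with row `j` replaced
  by row `b` of `W` — is again a minor `W[a[j ↦ b], ·]`; by maximality `H_{bj}` has valuation `≤ 1`,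
  i.e. `H_{bj} ∈ O`;
* `V = W · Q` for some `Q` (column basis), so `V[a, ·] = M · Q` and `H · V[a, ·] = W M⁻¹ M Q = W Q = V`.
-/

namespace Summit.ValiantsHypothesis.ValiantsHypothesis.Theorems.SublinearShadowSketch

-- `Summit.ValiantsHypothesis.ValiantsHypothesis.…` is the tree's mandated single-conjunct layout (Sub = Summit).
set_option linter.dupNamespace false

open Polynomial Finset IsLocalRing Matrix
open scoped BigOperators
open Literature.RingTheory.Valuation

/-- **Cramer's rule for a row vector against the inverse.** Over a field, `(v · M⁻¹)_j = det M_j(v) / det M`,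
where `M_j(v)` is `M` with row `j` replaced by `v` (with Mathlib's conventions `M⁻¹ = 0` and `0⁻¹ = 0` the
identity also holds for singular `M`). [folklore] -/
theorem mmf_vecMul_inv_apply {K n : Type*} [Field K] [Fintype n] [DecidableEq n]
    (M : Matrix n n K) (v : n → K) (j : n) :
    (v ᵥ* M⁻¹) j = M.det⁻¹ * (M.updateRow j v).det := by
  rw [Matrix.inv_def, Ring.inverse_eq_inv, Matrix.vecMul_smul, Pi.smul_apply, smul_eq_mul,
    ← Matrix.mulVec_transpose, Matrix.adjugate_transpose, ← Matrix.cramer_eq_adjugate_mulVec,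
    Matrix.cramer_transpose_apply]

/-- Replacing row `j` of the row-submatrix `W[a, ·]` by row `b` of `W` gives the row-submatrix
`W[a[j ↦ b], ·]`. -/
theorem mmf_updateRow_submatrix {K m n ι : Type*} [DecidableEq ι] (W : Matrix m n K) (a : ι → m)
    (j : ι) (b : m) :
    (W.submatrix a _root_.id).updateRow j (W b) = W.submatrix (Function.update a j b) _root_.id := by
  ext i k
  simp only [Matrix.updateRow_apply, Matrix.submatrix_apply, Function.update_apply, id_eq]
  split_ifs <;> rfl

/-- **Column basis.** Some `r ≤ s` columns `I : Fin r → Fin s` of a matrix `V ∈ K^{m × s}` over a field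
are linearly independent and span the column space of `V`. [folklore] -/
theorem mmf_colBasis {K m : Type*} [Field K] {s : ℕ} (V : Matrix m (Fin s) K) :
    ∃ (r : ℕ) (I : Fin r → Fin s), r ≤ s ∧ LinearIndependent K (V.submatrix _root_.id I).col ∧
      Submodule.span K (Set.range (V.submatrix _root_.id I).col) =
        Submodule.span K (Set.range V.col) := by
  classical
  obtain ⟨κ, f, hf, hspan, hli⟩ := exists_linearIndependent' (K := K) V.col
  haveI : Fintype κ := Fintype.ofInjective f hf
  have e1 : (V.submatrix _root_.id (f ∘ (Fintype.equivFin κ).symm)).col =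
      (V.col ∘ f) ∘ (Fintype.equivFin κ).symm := by
    funext j i; rfl
  refine ⟨Fintype.card κ, f ∘ (Fintype.equivFin κ).symm, ?_, ?_, ?_⟩
  · simpa using Fintype.card_le_of_injective f hf
  · rw [e1]; exact hli.comp _ (Fintype.equivFin κ).symm.injective
  · rw [e1, (Fintype.equivFin κ).symm.surjective.range_comp]; exact hspan

/-- A matrix over a field with `r` linearly independent columns (indexed by `Fin r`) has an invertible
`r × r` row-submatrix. [folklore] -/
theorem mmf_exists_det_ne_zero {K m : Type*} [Field K] [Fintype m] {r : ℕ} (W : Matrix m (Fin r) K)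
    (hW : LinearIndependent K W.col) : ∃ a : Fin r → m, (W.submatrix a _root_.id).det ≠ 0 := by
  classical
  have hrank : r ≤ Wᵀ.rank := by
    rw [Matrix.rank_transpose, Matrix.rank_eq_finrank_span_cols, finrank_span_eq_card hW,
      Fintype.card_fin]
  obtain ⟨a, -, hli⟩ :=
    Literature.LinearAlgebra.Matrix.exists_linearIndependent_cols_of_le_rank Wᵀ hrank
  refine ⟨a, ?_⟩
  have hrows : LinearIndependent K (W.submatrix a _root_.id).row := by
    have e2 : (W.submatrix a _root_.id).row = fun j => Wᵀ.col (a j) := by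
      funext j i; rfl
    rw [e2]; exact hli
  have hU := Matrix.linearIndependent_rows_iff_isUnit.1 hrows
  rw [Matrix.isUnit_iff_isUnit_det, isUnit_iff_ne_zero] at hU
  exact hU

/-- **The maximal minor.** If `W ∈ ℂ^{m × r}` has linearly independent columns then some row selection
`a : Fin r → m` maximises, over all row selections, the valuation at `O` of the minor `det W[a, ·]`, and
this maximal minor is nonzero. [folklore] -/
theorem mmf_exists_max_minor (O : ValuationSubring ℂ) {m : Type*} [Fintype m] {r : ℕ}
    (W : Matrix m (Fin r) ℂ) (hW : LinearIndependent ℂ W.col) :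
    ∃ a : Fin r → m, (W.submatrix a _root_.id).det ≠ 0 ∧
      ∀ a' : Fin r → m,
        O.valuation (W.submatrix a' _root_.id).det ≤ O.valuation (W.submatrix a _root_.id).det := by
  classical
  obtain ⟨a₀, ha₀⟩ := mmf_exists_det_ne_zero W hW
  obtain ⟨a, -, hmax⟩ := Finset.exists_max_image Finset.univ
    (fun a : Fin r → m => O.valuation (W.submatrix a _root_.id).det) ⟨a₀, Finset.mem_univ _⟩
  refine ⟨a, fun h0 => ?_, fun a' => hmax a' (Finset.mem_univ _)⟩
  have h1 := lt_of_lt_of_le ((Valuation.pos_iff _).2 ha₀) (hmax a₀ (Finset.mem_univ _))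
  rw [h0, _root_.map_zero] at h1
  exact lt_irrefl _ h1

/-- **Maximal-minor factorisation of a matrix with independent columns.** If `W ∈ ℂ^{m × r}` has linearly
independent columns then, for a row selection `a` whose minor `M = W[a, ·]` has maximal valuation at `O`,
the matrix `H = W · M⁻¹` is `O`-integral (Cramer's rule), `H[a, ·] = 1`, and `W = H · W[a, ·]`.
[folklore] -/
theorem mmf_core (O : ValuationSubring ℂ) {m : Type*} [Fintype m] {r : ℕ}
    (W : Matrix m (Fin r) ℂ) (hW : LinearIndependent ℂ W.col) :
    ∃ (a : Fin r → m) (H : Matrix m (Fin r) ℂ), (∀ b j, H b j ∈ O) ∧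
      (∀ j j', H (a j') j = if j = j' then 1 else 0) ∧ W = H * W.submatrix a _root_.id := by
  classical
  obtain ⟨a, hdet, hmax⟩ := mmf_exists_max_minor O W hW
  have hMu : IsUnit (W.submatrix a _root_.id).det := isUnit_iff_ne_zero.2 hdet
  refine ⟨a, W * (W.submatrix a _root_.id)⁻¹, fun b j => ?_, fun j j' => ?_, ?_⟩
  · -- integrality: Cramer's rule and the maximality of the minor
    have e : (W * (W.submatrix a _root_.id)⁻¹) b j =
        ((W.submatrix a _root_.id).det)⁻¹ * (W.submatrix (Function.update a j b) _root_.id).det := by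
      rw [← mmf_updateRow_submatrix]
      exact mmf_vecMul_inv_apply _ (W b) j
    rw [e, ← O.valuation_le_one_iff, _root_.map_mul, _root_.map_inv₀]
    have hv : O.valuation (W.submatrix a _root_.id).det ≠ 0 := (Valuation.ne_zero_iff _).2 hdet
    calc (O.valuation (W.submatrix a _root_.id).det)⁻¹ *
          O.valuation (W.submatrix (Function.update a j b) _root_.id).det
        ≤ (O.valuation (W.submatrix a _root_.id).det)⁻¹ * O.valuation (W.submatrix a _root_.id).det :=
          mul_le_mul_right (hmax _) _
      _ = 1 := inv_mul_cancel₀ hv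
  · -- normalisation: `H[a, ·] = M · M⁻¹ = 1`
    change (W.submatrix a _root_.id * (W.submatrix a _root_.id)⁻¹) j' j = _
    rw [Matrix.mul_nonsing_inv _ hMu]
    by_cases h : j = j'
    · subst h; simp
    · rw [Matrix.one_apply_ne (Ne.symm h), if_neg h]
  · rw [Matrix.mul_assoc, Matrix.nonsing_inv_mul _ hMu, Matrix.mul_one]

/-- **Stub (G1): maximal-minor factorisation.**  Over a valuation subring `O ⊂ ℂ`, every matrix `V ∈ ℂ^{m × s}` factors
through `r ≤ s` of its own rows: `V = H · V[a,·]` with `H ∈ O^{m × r}` and `H[a_{j'}, j] = δ_{jj'}`.  (Column basis `I`, then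
rows `a` maximising the valuation of `det V[a, I]`; `H = V[·, I] · V[a, I]⁻¹` is `O`-integral by Cramer's rule.) [folklore] -/
theorem stub_maxMinorFactor (O : ValuationSubring ℂ) {m : Type} [Fintype m] [DecidableEq m] (s : ℕ)
    (V : Matrix m (Fin s) ℂ) :
    ∃ (r : ℕ) (a : Fin r → m) (H : Matrix m (Fin r) ℂ),
      r ≤ s ∧ (∀ b j, H b j ∈ O) ∧ (∀ j j', H (a j') j = if j = j' then 1 else 0) ∧
      V = H * V.submatrix a _root_.id := by
  obtain ⟨r, I, hrs, hli, hspan⟩ := mmf_colBasis V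
  obtain ⟨a, H, hint, hone, hfac⟩ := mmf_core O (V.submatrix _root_.id I) hli
  refine ⟨r, a, H, hrs, hint, hone, ?_⟩
  -- every column of `V` is a combination of the basis columns: `V = V[·, I] · Q`
  have hcol : ∀ i, V.col i ∈ Submodule.span ℂ (Set.range (V.submatrix _root_.id I).col) := fun i => by
    rw [hspan]; exact Submodule.subset_span (Set.mem_range_self i)
  choose P hP using fun i => (Submodule.mem_span_range_iff_exists_fun ℂ).1 (hcol i)
  have hVQ : V = V.submatrix _root_.id I * Matrix.of (fun j i => P i j) := by
    ext b i
    have h := congrFun (hP i) b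
    simp only [Finset.sum_apply, Pi.smul_apply, smul_eq_mul, Matrix.col_apply] at h
    rw [Matrix.mul_apply, ← h]
    exact Finset.sum_congr rfl fun j _ => by rw [Matrix.of_apply, mul_comm]
  calc V = V.submatrix _root_.id I * Matrix.of (fun j i => P i j) := hVQ
    _ = H * (V.submatrix _root_.id I).submatrix a _root_.id * Matrix.of (fun j i => P i j) := by
        rw [← hfac]
    _ = H * (V.submatrix _root_.id I * Matrix.of (fun j i => P i j)).submatrix a _root_.id := by
        rw [Matrix.submatrix_mul _ _ a _root_.id _root_.id Function.bijective_id, Matrix.submatrix_id_id,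
          Matrix.mul_assoc]
    _ = H * V.submatrix a _root_.id := by rw [← hVQ]

end Summit.ValiantsHypothesis.ValiantsHypothesis.Theorems.SublinearShadowSketch
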